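import Summits.Ventures.WeilGRH.UniformConductorFloorJointDataLog11
import HarnessLib

/-!
# GRH arm (rh-explicit, venture WeilGRH): kernel check of the EVEN joint cell certificate `certEvenLog11` at `(log 11)/2` — part A

Cell `rh-explicit`, WEIL TRACK — GRH ARM (weil-grh-1, gen9).  `JointCert.checkFrame` and the cells `[0, 192)` of `certEvenLog11`
(`UniformConductorFloorJointDataLog11.lean`) by `decide +kernel` (integer arithmetic only; one range per file).  Glued in `UniformConductorFloorJointFloorsLog11.lean` by
`JointCert.cellsLoop_spec`.  No definitions; no named facts; standard axioms. [folklore]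
-/

namespace Summit.Ventures.WeilGRH

namespace UniformFloor

set_option maxHeartbeats 0 in
set_option maxRecDepth 100000 in
/-- The frame of `certEvenLog11` checks (shape, `φ` bounds, shifts, exact slab masses, exact constant, `e^{2t} ≤ 12`). [folklore] -/
theorem certEvenLog11_checkFrame : certEvenLog11.checkFrame = true := by
  decide +kernel

set_option maxHeartbeats 0 in
set_option maxRecDepth 100000 in
/-- Cells `[0, 192)` of `certEvenLog11` (the zipper `JointCert.cellsRange`). [folklore] -/
theorem certEvenLog11_cellsA : certEvenLog11.cellsRange 0 192 = true := by
  decide +kernel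

end UniformFloor

end Summit.Ventures.WeilGRH
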